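import Summits.QuantumFields.BalabanUV.Beta.D1BFx.PackedColumnBlockTotalScales
import Summits.QuantumFields.BalabanUV.Beta.D1BFx.PackedCoframeSep

/-!
# `BalabanUV.Beta.D1BFx.PackedPairBlockIndexedMass` — road «BF-x» junction (J1), the PAIR contact families (the words file's (W-pair): both slots of `S₂⁰`
# transported by leaf-03's `slotPsiS`, TT4 `vertex2OfK_conj_psiKS`): **«PAIR-FACE-PACK» — THE BLOCK-PAIR-TOTAL LETTER OF A PAIR FAMILY THAT IS BLOCK-INDEXED
# IN THE OUTER SLOT, IN THE INNER SLOT, OR IN BOTH, FACTORISES EXACTLY (plain masses): «block-ℓ¹ norm of the slot weights × the block(-pair) total of the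
# block table»; HENCE THE (M-b) PACKED BI-VERTEX ROWS OF THE THREE PAIR CONTACT PIECES (face × raw, raw × face, face × face) FROM THE WEIGHTS' BLOCK-ℓ¹ LAW
# AND THREE DISPLAYED PAIR-MASS LETTERS** (UNCONDITIONAL; [folklore] bookkeeping over `PackedColumnBlockPairTotalMass` ∕ `…Scales` §3)

HONEST DEPENDENCY (cell records, verbatim): «continuum YM on T⁴ ⇐ BetaPertH ∧ nine spine estimates (0/9 proved); BetaPertH ⇐ (D1) ∧ (D4) ∧
CAP+tail; G-an2-4 gates asym, D1 and NE2/3/4.»  HONEST FRAMING (cell contract, verbatim): «discharging `BetaPertH` makes Bałaban's UV stability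
UNCONDITIONAL — a real constructive-QFT result; it is NOT the continuum limit and NOT the Clay problem.»  THIS MODULE DISCHARGES NOTHING of the
wall: [folklore] `ℓ¹` bookkeeping BY NAME (leaf-03's `PackedCoframeSep.mass_smul_le`, this lineage's `PackedColumnBlockTotalScales.mass_blk_vertex2OfK_G₀_le_of_blockPairTotal_at`).
Every letter is a DISPLAYED hypothesis on an ARBITRARY pair family; the block-indexed structure is a DISPLAYED pointwise hypothesis (no face family defined or used);
nothing of Bałaban's (or an1's ∕ an3's) tables asserted.  No definition, no `def … : Prop`, nothing cited, 0 sorry.  NO (1.22) row; 0 root-level binders of row D1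
discharged; (J1) = ONE OPEN ROW `hC₁ := Δ_n`; [W] OPEN; (K) NOT closed; NOT D1, NOT `BetaPertH`, NOT continuum, NOT Clay.

ABSOLUTE RULE (cell charter, verbatim): «No internally-minted statement may enter as a cited fact. Every hypothesis is either kernel-proved in
this package or a verbatim quotation of a PUBLISHED theorem with page reference. The manuscript(s) under audit are NOT citable for their own
disputed steps — they are the thing under adjudication; programme-internal (2001/route/tribunal) claims are never citable.»

WHY: leaf-03 g29's TT4 `SymCorrectorPair.vertex2OfK_conj_psiKS` transports BOTH slots of a pair family: `vertex2OfK (Ψ̂KΨ̂ᵀ) n S₂ = vertex2OfK K n (α x ↦ slotPsiS (slotPsiS S₂ α x))`,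
so the pair contact family `S₂^c := slotPsiS∘slotPsiS S₂ − S₂` is the sum of THREE pieces — outer-face × raw (`faceWt α x • faceSum_outer`), raw × inner-face, face × face —
each BLOCK-INDEXED in the transported slot(s).  The (M-b) pair currency of this lineage (`PackedColumnBlockPairTotalMass`, block-PAIR totals with coarse decay
`≤ n⁸·m̄B·e^{−θ|y₂−y₁|₁}`, PLAIN masses) factorises on such pieces EXACTLY (no recentring: plain masses are translation-blind): §1 below.  With the weights' block-ℓ¹ law
`Σ_{b ∈ box} |c κ (n•y′+b)| ≤ n·cW` (this lineage's `BondIndicatorGaugeL1.sum_box_abs_faceWeight_le`, `cW = d+1`) the three pieces' block-pair totals come from three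
DISPLAYED pair-mass letters of the natural powers `n⁷` (face × block), `n⁷` (block × face), `n⁶` (face × face) — §2 — and §3 reads the packed bi-vertex rows off
`mass_blk_vertex2OfK_G₀_le_of_blockPairTotal_at`.  The road types no [M] row on the contact families before the decider (OWNER d1-p2 g23 W-g23-3); this is the
bookkeeping that makes the pair row's remaining inputs explicit counts.

CONTENT ([folklore]).  §1 GENERIC (any `D`, any fibre, plain masses; `PackedCoframeSep.mass_smul_le` BY NAME): `blockPairTotal_eq_of_outerIndexed`, `blockPairTotal_eq_of_innerIndexed`,
`blockPairTotal_eq_of_bothIndexed` (exact factorisations), `blockPairTotal_add_le` (subadditivity: the three pieces' letters add to ONE `hTB` for the contact pair family).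
§2∕§3 `d = 3`: the three pieces' `hTB` letters and the packed bi-vertex rows at `G₀^{bm}(r)` (`[NeZero N]`).
Unit `b2b-balaban-gan24-formalise-leaf-05` (gen 58), G-an2-4 swarm leaf prover 05, road «BF-x» supplier; INTENT-4 «PAIR-FACE-PACK» (journal).
-/

noncomputable section

open Finset
open scoped BigOperators
open Literature.MathematicalPhysics.QuantumFieldTheory
open Literature.MathematicalPhysics.QuantumFieldTheory.Balaban1983to89
open Literature.MathematicalPhysics.QuantumFieldTheory.Balaban1983to89.Beta
open B12Sec2to5 (l1 l1_nonneg)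
open B5Hk163Strip (kappa163 kappa163_pos)
open B5Hk163Decay (MG163)
open B4TorusKernel (periodConst)
open ExpKernelCalculus (Site MKer Zl)
open AffineAveraging (box toSite)
open OneStepResolventKernel (Fib)
open OneStepKernelFamily (KInvStep)
open Summit.QuantumFields.BalabanUV.Beta.AxialDressingRooted (coDressKBmAt)
open Summit.QuantumFields.BalabanUV.Beta.D1BFx.PackedKernelSplit (blk)
open SecondOrderResponse (vertex2OfK)
open Summit.QuantumFields.BalabanUV.Beta.D1BFx.PackedCoframeSep (mass_smul_le mass_add_le)
open Summit.QuantumFields.BalabanUV.Beta.D1BFx.PackedColumnBlockTotalScales (mass_blk_vertex2OfK_G₀_le_of_blockPairTotal_at)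

namespace Summit.QuantumFields.BalabanUV.Beta.D1BFx.PackedPairBlockIndexedMass

/-! ## §1 Generic: block-pair totals of slot-indexed pair families factorise exactly (plain masses) -/

section Generic

variable {D : ℕ} {F : Type*} [Fintype F]

/-- [folklore] **OUTER-SLOT-INDEXED PAIR FAMILY: THE BLOCK-PAIR TOTAL FACTORISES EXACTLY** (GENERIC; any `D`, block side `n`, any fibre, plain masses): if on the
outer block `y₁` the pair family reads `P (n•y₁ + b) u′ = c (n•y₁ + b) • G u′` (one inner family `G` per outer block, a scalar weight per outer slot) and every `G u′`
has summable plain mass, then `Σ_{b, b′ ∈ box} M(P (n•y₁+b) (n•y₂+b′)) = (Σ_b |c (n•y₁+b)|) · Σ_{b′} M(G (n•y₂+b′))`. -/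
theorem blockPairTotal_eq_of_outerIndexed {n : ℕ} {P : Site D → Site D → MKer D F} {c : Site D → ℝ} {G : Site D → MKer D F} (y₁ y₂ : Site D)
    (hP : ∀ b ∈ box D n, ∀ u', P ((n : ℤ) • y₁ + toSite b) u' = c ((n : ℤ) • y₁ + toSite b) • G u')
    (hGs : ∀ u', Summable fun p : Site D × Site D => ∑ a, ∑ b, |G u' p.1 p.2 a b|) :
    (∀ b ∈ box D n, ∀ b' ∈ box D n, Summable fun p : Site D × Site D =>
        ∑ a, ∑ f, |P ((n : ℤ) • y₁ + toSite b) ((n : ℤ) • y₂ + toSite b') p.1 p.2 a f|) ∧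
      ∑ b ∈ box D n, ∑ b' ∈ box D n, (∑' p : Site D × Site D, ∑ a, ∑ f, |P ((n : ℤ) • y₁ + toSite b) ((n : ℤ) • y₂ + toSite b') p.1 p.2 a f|)
        = (∑ b ∈ box D n, |c ((n : ℤ) • y₁ + toSite b)|)
          * ∑ b' ∈ box D n, (∑' p : Site D × Site D, ∑ a, ∑ f, |G ((n : ℤ) • y₂ + toSite b') p.1 p.2 a f|) := by
  refine ⟨fun b hb b' _ => ?_, ?_⟩
  · rw [hP b hb]; exact (mass_smul_le _ (hGs _)).1
  · rw [Finset.sum_mul]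
    refine Finset.sum_congr rfl fun b hb => ?_
    rw [Finset.mul_sum]
    refine Finset.sum_congr rfl fun b' _ => ?_
    rw [hP b hb]; exact (mass_smul_le _ (hGs _)).2

/-- [folklore] **INNER-SLOT-INDEXED PAIR FAMILY**: `P u (n•y₂ + b′) = c′ (n•y₂ + b′) • H u` ⟹
`Σ_{b, b′} M(P (n•y₁+b) (n•y₂+b′)) = (Σ_{b′} |c′ (n•y₂+b′)|) · Σ_b M(H (n•y₁+b))`. -/
theorem blockPairTotal_eq_of_innerIndexed {n : ℕ} {P : Site D → Site D → MKer D F} {c' : Site D → ℝ} {H : Site D → MKer D F} (y₁ y₂ : Site D)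
    (hP : ∀ b' ∈ box D n, ∀ u, P u ((n : ℤ) • y₂ + toSite b') = c' ((n : ℤ) • y₂ + toSite b') • H u)
    (hHs : ∀ u, Summable fun p : Site D × Site D => ∑ a, ∑ b, |H u p.1 p.2 a b|) :
    (∀ b ∈ box D n, ∀ b' ∈ box D n, Summable fun p : Site D × Site D =>
        ∑ a, ∑ f, |P ((n : ℤ) • y₁ + toSite b) ((n : ℤ) • y₂ + toSite b') p.1 p.2 a f|) ∧
      ∑ b ∈ box D n, ∑ b' ∈ box D n, (∑' p : Site D × Site D, ∑ a, ∑ f, |P ((n : ℤ) • y₁ + toSite b) ((n : ℤ) • y₂ + toSite b') p.1 p.2 a f|)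
        = (∑ b' ∈ box D n, |c' ((n : ℤ) • y₂ + toSite b')|)
          * ∑ b ∈ box D n, (∑' p : Site D × Site D, ∑ a, ∑ f, |H ((n : ℤ) • y₁ + toSite b) p.1 p.2 a f|) := by
  refine ⟨fun b _ b' hb' => ?_, ?_⟩
  · rw [hP b' hb']; exact (mass_smul_le _ (hHs _)).1
  · rw [Finset.sum_comm, Finset.sum_mul]
    refine Finset.sum_congr rfl fun b' hb' => ?_
    rw [Finset.mul_sum]
    refine Finset.sum_congr rfl fun b _ => ?_
    rw [hP b' hb']; exact (mass_smul_le _ (hHs _)).2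

/-- [folklore] **BOTH SLOTS INDEXED**: `P (n•y₁ + b) (n•y₂ + b′) = (c (n•y₁+b) * c′ (n•y₂+b′)) • J` ⟹
`Σ_{b, b′} M(P …) = (Σ_b |c (n•y₁+b)|) · (Σ_{b′} |c′ (n•y₂+b′)|) · M(J)`. -/
theorem blockPairTotal_eq_of_bothIndexed {n : ℕ} {P : Site D → Site D → MKer D F} {c c' : Site D → ℝ} {J : MKer D F} (y₁ y₂ : Site D)
    (hP : ∀ b ∈ box D n, ∀ b' ∈ box D n,
      P ((n : ℤ) • y₁ + toSite b) ((n : ℤ) • y₂ + toSite b') = (c ((n : ℤ) • y₁ + toSite b) * c' ((n : ℤ) • y₂ + toSite b')) • J)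
    (hJs : Summable fun p : Site D × Site D => ∑ a, ∑ b, |J p.1 p.2 a b|) :
    (∀ b ∈ box D n, ∀ b' ∈ box D n, Summable fun p : Site D × Site D =>
        ∑ a, ∑ f, |P ((n : ℤ) • y₁ + toSite b) ((n : ℤ) • y₂ + toSite b') p.1 p.2 a f|) ∧
      ∑ b ∈ box D n, ∑ b' ∈ box D n, (∑' p : Site D × Site D, ∑ a, ∑ f, |P ((n : ℤ) • y₁ + toSite b) ((n : ℤ) • y₂ + toSite b') p.1 p.2 a f|)
        = (∑ b ∈ box D n, |c ((n : ℤ) • y₁ + toSite b)|) * (∑ b' ∈ box D n, |c' ((n : ℤ) • y₂ + toSite b')|)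
          * ∑' p : Site D × Site D, ∑ a, ∑ f, |J p.1 p.2 a f| := by
  refine ⟨fun b hb b' hb' => ?_, ?_⟩
  · rw [hP b hb b' hb']; exact (mass_smul_le _ hJs).1
  · have e : ∀ b ∈ box D n, ∀ b' ∈ box D n,
        (∑' p : Site D × Site D, ∑ a, ∑ f, |P ((n : ℤ) • y₁ + toSite b) ((n : ℤ) • y₂ + toSite b') p.1 p.2 a f|)
          = |c ((n : ℤ) • y₁ + toSite b)| * (|c' ((n : ℤ) • y₂ + toSite b')| * ∑' p : Site D × Site D, ∑ a, ∑ f, |J p.1 p.2 a f|) := by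
      intro b hb b' hb'
      rw [hP b hb b' hb', (mass_smul_le _ hJs).2, abs_mul, mul_assoc]
    rw [Finset.sum_congr rfl fun b hb => Finset.sum_congr rfl fun b' hb' => e b hb b' hb']
    simp only [← Finset.mul_sum, ← Finset.sum_mul]
    ring

/-- [folklore] **BLOCK-PAIR TOTALS ARE SUBADDITIVE** (GENERIC): for two pair slot families with summable plain masses, the block-pair total of `P + Q` is at most the
sum of the two block-pair totals (`PackedCoframeSep.mass_add_le` termwise) — so the three contact pieces' letters add up to ONE `hTB` for their sum. -/
theorem blockPairTotal_add_le {n : ℕ} {P Q : Site D → Site D → MKer D F} (y₁ y₂ : Site D)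
    (hPs : ∀ u u', Summable fun p : Site D × Site D => ∑ a, ∑ b, |P u u' p.1 p.2 a b|)
    (hQs : ∀ u u', Summable fun p : Site D × Site D => ∑ a, ∑ b, |Q u u' p.1 p.2 a b|) :
    (∀ u u', Summable fun p : Site D × Site D => ∑ a, ∑ b, |(P u u' + Q u u') p.1 p.2 a b|) ∧
      ∑ b ∈ box D n, ∑ b' ∈ box D n, (∑' p : Site D × Site D, ∑ a, ∑ f,
          |(P ((n : ℤ) • y₁ + toSite b) ((n : ℤ) • y₂ + toSite b') + Q ((n : ℤ) • y₁ + toSite b) ((n : ℤ) • y₂ + toSite b')) p.1 p.2 a f|)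
        ≤ (∑ b ∈ box D n, ∑ b' ∈ box D n, (∑' p : Site D × Site D, ∑ a, ∑ f, |P ((n : ℤ) • y₁ + toSite b) ((n : ℤ) • y₂ + toSite b') p.1 p.2 a f|))
          + ∑ b ∈ box D n, ∑ b' ∈ box D n, (∑' p : Site D × Site D, ∑ a, ∑ f, |Q ((n : ℤ) • y₁ + toSite b) ((n : ℤ) • y₂ + toSite b') p.1 p.2 a f|) := by
  refine ⟨fun u u' => (mass_add_le (hPs u u') (hQs u u')).1, ?_⟩
  rw [← Finset.sum_add_distrib]
  refine Finset.sum_le_sum fun b _ => ?_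
  rw [← Finset.sum_add_distrib]
  exact Finset.sum_le_sum fun b' _ => (mass_add_le (hPs _ _) (hQs _ _)).2

end Generic

/-! ## §2 `d = 3`: the block-pair totals of the three pair contact pieces from the weights' block-ℓ¹ law and three pair-mass letters -/

section Pieces

variable (N : ℕ)

/-- [folklore] **OUTER-FACE × RAW PIECE** `P κ (N•y₁ + b) κ′ u′ = c κ (N•y₁ + b) • G κ y₁ κ′ u′`: with the weights' block-ℓ¹ law `Σ_b |c κ (N•y₁+b)| ≤ N·cW` and the
«face × block» pair-mass letter `Σ_{b′ ∈ box} M(blk (G κ y₁ κ′ (N•y₂+b′)) j i) ≤ N⁷·m̄G j i·e^{−θ|y₂−y₁|₁}` (`0 ≤ cW`), the block-pair totals of `P` are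
`≤ N⁸·(cW·m̄G j i)·e^{−θ|y₂−y₁|₁}` — the `hTB` binder of `PackedColumnBlockPairTotalMass` §3∕§4. -/
theorem hTB_of_outerIndexed {P : Fin 4 → Site 4 → Fin 4 → Site 4 → MKer 4 (Fib 3)} {c : Fin 4 → Site 4 → ℝ}
    {G : Fin 4 → Site 4 → Fin 4 → Site 4 → MKer 4 (Fib 3)} {cW θ : ℝ} {mG : Bool → Bool → ℝ} (hcW : 0 ≤ cW)
    (hP : ∀ (κ : Fin 4) (y₁ : Site 4), ∀ b ∈ box 4 N, ∀ (κ' : Fin 4) (u' : Site 4),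
      P κ (((N : ℕ) : ℤ) • y₁ + toSite b) κ' u' = c κ (((N : ℕ) : ℤ) • y₁ + toSite b) • G κ y₁ κ' u')
    (hGs : ∀ κ y₁ κ' u' j i, Summable fun p : Site 4 × Site 4 => ∑ g, ∑ f, |blk (G κ y₁ κ' u') j i p.1 p.2 g f|)
    (hcB : ∀ (κ : Fin 4) (y₁ : Site 4), ∑ b ∈ box 4 N, |c κ (((N : ℕ) : ℤ) • y₁ + toSite b)| ≤ (N : ℝ) * cW)
    (hGB : ∀ (κ κ' : Fin 4) (y₁ y₂ : Site 4) (j i : Bool), ∑ b' ∈ box 4 N,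
      (∑' p : Site 4 × Site 4, ∑ g, ∑ f, |blk (G κ y₁ κ' (((N : ℕ) : ℤ) • y₂ + toSite b')) j i p.1 p.2 g f|)
        ≤ (N : ℝ) ^ 7 * mG j i * Real.exp (-θ * l1 (y₂ - y₁)))
    (κ κ' : Fin 4) (y₁ y₂ : Site 4) (j i : Bool) :
    ∑ b ∈ box 4 N, ∑ b' ∈ box 4 N,
      (∑' p : Site 4 × Site 4, ∑ g, ∑ f, |blk (P κ (((N : ℕ) : ℤ) • y₁ + toSite b) κ' (((N : ℕ) : ℤ) • y₂ + toSite b')) j i p.1 p.2 g f|)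
        ≤ (N : ℝ) ^ 8 * (cW * mG j i) * Real.exp (-θ * l1 (y₂ - y₁)) := by
  have hblk : ∀ b ∈ box 4 N, ∀ u', (fun u u' => blk (P κ u κ' u') j i) (((N : ℕ) : ℤ) • y₁ + toSite b) u'
      = c κ (((N : ℕ) : ℤ) • y₁ + toSite b) • blk (G κ y₁ κ' u') j i := by
    intro b hb u'
    show blk (P κ (((N : ℕ) : ℤ) • y₁ + toSite b) κ' u') j i = _
    rw [hP κ y₁ b hb κ' u']; rfl
  have h := (blockPairTotal_eq_of_outerIndexed (P := fun u u' => blk (P κ u κ' u') j i) (c := c κ)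
    (G := fun u' => blk (G κ y₁ κ' u') j i) y₁ y₂ hblk (fun u' => hGs κ y₁ κ' u' j i)).2
  rw [h]
  have hM0 : 0 ≤ ∑ b' ∈ box 4 N, (∑' p : Site 4 × Site 4, ∑ g, ∑ f, |blk (G κ y₁ κ' (((N : ℕ) : ℤ) • y₂ + toSite b')) j i p.1 p.2 g f|) :=
    Finset.sum_nonneg fun b' _ => tsum_nonneg fun p => Finset.sum_nonneg fun g _ => Finset.sum_nonneg fun f _ => abs_nonneg _
  calc (∑ b ∈ box 4 N, |c κ (((N : ℕ) : ℤ) • y₁ + toSite b)|)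
        * ∑ b' ∈ box 4 N, (∑' p : Site 4 × Site 4, ∑ g, ∑ f, |blk (G κ y₁ κ' (((N : ℕ) : ℤ) • y₂ + toSite b')) j i p.1 p.2 g f|)
      ≤ ((N : ℝ) * cW) * ((N : ℝ) ^ 7 * mG j i * Real.exp (-θ * l1 (y₂ - y₁))) :=
        mul_le_mul (hcB κ y₁) (hGB κ κ' y₁ y₂ j i) hM0 (by positivity)
    _ = (N : ℝ) ^ 8 * (cW * mG j i) * Real.exp (-θ * l1 (y₂ - y₁)) := by ring

/-- [folklore] **RAW × INNER-FACE PIECE** `P κ u κ′ (N•y₂ + b′) = c κ′ (N•y₂ + b′) • H κ u κ′ y₂`: with the weights' block-ℓ¹ law and the «block × face» pair-mass letter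
`Σ_{b ∈ box} M(blk (H κ (N•y₁+b) κ′ y₂) j i) ≤ N⁷·m̄H j i·e^{−θ|y₂−y₁|₁}`, the block-pair totals of `P` are `≤ N⁸·(cW·m̄H j i)·e^{−θ|y₂−y₁|₁}`. -/
theorem hTB_of_innerIndexed {P : Fin 4 → Site 4 → Fin 4 → Site 4 → MKer 4 (Fib 3)} {c : Fin 4 → Site 4 → ℝ}
    {H : Fin 4 → Site 4 → Fin 4 → Site 4 → MKer 4 (Fib 3)} {cW θ : ℝ} {mH : Bool → Bool → ℝ} (hcW : 0 ≤ cW)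
    (hP : ∀ (κ : Fin 4) (u : Site 4) (κ' : Fin 4) (y₂ : Site 4), ∀ b' ∈ box 4 N,
      P κ u κ' (((N : ℕ) : ℤ) • y₂ + toSite b') = c κ' (((N : ℕ) : ℤ) • y₂ + toSite b') • H κ u κ' y₂)
    (hHs : ∀ κ u κ' y₂ j i, Summable fun p : Site 4 × Site 4 => ∑ g, ∑ f, |blk (H κ u κ' y₂) j i p.1 p.2 g f|)
    (hcB : ∀ (κ' : Fin 4) (y₂ : Site 4), ∑ b' ∈ box 4 N, |c κ' (((N : ℕ) : ℤ) • y₂ + toSite b')| ≤ (N : ℝ) * cW)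
    (hHB : ∀ (κ κ' : Fin 4) (y₁ y₂ : Site 4) (j i : Bool), ∑ b ∈ box 4 N,
      (∑' p : Site 4 × Site 4, ∑ g, ∑ f, |blk (H κ (((N : ℕ) : ℤ) • y₁ + toSite b) κ' y₂) j i p.1 p.2 g f|)
        ≤ (N : ℝ) ^ 7 * mH j i * Real.exp (-θ * l1 (y₂ - y₁)))
    (κ κ' : Fin 4) (y₁ y₂ : Site 4) (j i : Bool) :
    ∑ b ∈ box 4 N, ∑ b' ∈ box 4 N,
      (∑' p : Site 4 × Site 4, ∑ g, ∑ f, |blk (P κ (((N : ℕ) : ℤ) • y₁ + toSite b) κ' (((N : ℕ) : ℤ) • y₂ + toSite b')) j i p.1 p.2 g f|)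
        ≤ (N : ℝ) ^ 8 * (cW * mH j i) * Real.exp (-θ * l1 (y₂ - y₁)) := by
  have hblk : ∀ b' ∈ box 4 N, ∀ u, (fun u u' => blk (P κ u κ' u') j i) u (((N : ℕ) : ℤ) • y₂ + toSite b')
      = c κ' (((N : ℕ) : ℤ) • y₂ + toSite b') • blk (H κ u κ' y₂) j i := by
    intro b' hb' u
    show blk (P κ u κ' (((N : ℕ) : ℤ) • y₂ + toSite b')) j i = _
    rw [hP κ u κ' y₂ b' hb']; rfl
  have h := (blockPairTotal_eq_of_innerIndexed (P := fun u u' => blk (P κ u κ' u') j i) (c' := c κ')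
    (H := fun u => blk (H κ u κ' y₂) j i) y₁ y₂ hblk (fun u => hHs κ u κ' y₂ j i)).2
  rw [h]
  have hM0 : 0 ≤ ∑ b ∈ box 4 N, (∑' p : Site 4 × Site 4, ∑ g, ∑ f, |blk (H κ (((N : ℕ) : ℤ) • y₁ + toSite b) κ' y₂) j i p.1 p.2 g f|) :=
    Finset.sum_nonneg fun b _ => tsum_nonneg fun p => Finset.sum_nonneg fun g _ => Finset.sum_nonneg fun f _ => abs_nonneg _
  calc (∑ b' ∈ box 4 N, |c κ' (((N : ℕ) : ℤ) • y₂ + toSite b')|)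
        * ∑ b ∈ box 4 N, (∑' p : Site 4 × Site 4, ∑ g, ∑ f, |blk (H κ (((N : ℕ) : ℤ) • y₁ + toSite b) κ' y₂) j i p.1 p.2 g f|)
      ≤ ((N : ℝ) * cW) * ((N : ℝ) ^ 7 * mH j i * Real.exp (-θ * l1 (y₂ - y₁))) :=
        mul_le_mul (hcB κ' y₂) (hHB κ κ' y₁ y₂ j i) hM0 (by positivity)
    _ = (N : ℝ) ^ 8 * (cW * mH j i) * Real.exp (-θ * l1 (y₂ - y₁)) := by ring

/-- [folklore] **FACE × FACE PIECE** `P κ (N•y₁ + b) κ′ (N•y₂ + b′) = (c κ (N•y₁+b)·c κ′ (N•y₂+b′)) • J κ y₁ κ′ y₂`: with the weights' block-ℓ¹ law (twice) and the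
«face × face» pair-mass letter `M(blk (J κ y₁ κ′ y₂) j i) ≤ N⁶·m̄J j i·e^{−θ|y₂−y₁|₁}`, the block-pair totals of `P` are `≤ N⁸·(cW²·m̄J j i)·e^{−θ|y₂−y₁|₁}`. -/
theorem hTB_of_bothIndexed {P : Fin 4 → Site 4 → Fin 4 → Site 4 → MKer 4 (Fib 3)} {c : Fin 4 → Site 4 → ℝ}
    {J : Fin 4 → Site 4 → Fin 4 → Site 4 → MKer 4 (Fib 3)} {cW θ : ℝ} {mJ : Bool → Bool → ℝ} (hcW : 0 ≤ cW)
    (hP : ∀ (κ : Fin 4) (y₁ : Site 4), ∀ b ∈ box 4 N, ∀ (κ' : Fin 4) (y₂ : Site 4), ∀ b' ∈ box 4 N,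
      P κ (((N : ℕ) : ℤ) • y₁ + toSite b) κ' (((N : ℕ) : ℤ) • y₂ + toSite b')
        = (c κ (((N : ℕ) : ℤ) • y₁ + toSite b) * c κ' (((N : ℕ) : ℤ) • y₂ + toSite b')) • J κ y₁ κ' y₂)
    (hJs : ∀ κ y₁ κ' y₂ j i, Summable fun p : Site 4 × Site 4 => ∑ g, ∑ f, |blk (J κ y₁ κ' y₂) j i p.1 p.2 g f|)
    (hcB : ∀ (κ : Fin 4) (y : Site 4), ∑ b ∈ box 4 N, |c κ (((N : ℕ) : ℤ) • y + toSite b)| ≤ (N : ℝ) * cW)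
    (hJB : ∀ (κ κ' : Fin 4) (y₁ y₂ : Site 4) (j i : Bool),
      (∑' p : Site 4 × Site 4, ∑ g, ∑ f, |blk (J κ y₁ κ' y₂) j i p.1 p.2 g f|) ≤ (N : ℝ) ^ 6 * mJ j i * Real.exp (-θ * l1 (y₂ - y₁)))
    (κ κ' : Fin 4) (y₁ y₂ : Site 4) (j i : Bool) :
    ∑ b ∈ box 4 N, ∑ b' ∈ box 4 N,
      (∑' p : Site 4 × Site 4, ∑ g, ∑ f, |blk (P κ (((N : ℕ) : ℤ) • y₁ + toSite b) κ' (((N : ℕ) : ℤ) • y₂ + toSite b')) j i p.1 p.2 g f|)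
        ≤ (N : ℝ) ^ 8 * (cW ^ 2 * mJ j i) * Real.exp (-θ * l1 (y₂ - y₁)) := by
  have hblk : ∀ b ∈ box 4 N, ∀ b' ∈ box 4 N, (fun u u' => blk (P κ u κ' u') j i) (((N : ℕ) : ℤ) • y₁ + toSite b) (((N : ℕ) : ℤ) • y₂ + toSite b')
      = (c κ (((N : ℕ) : ℤ) • y₁ + toSite b) * c κ' (((N : ℕ) : ℤ) • y₂ + toSite b')) • blk (J κ y₁ κ' y₂) j i := by
    intro b hb b' hb'
    show blk (P κ (((N : ℕ) : ℤ) • y₁ + toSite b) κ' (((N : ℕ) : ℤ) • y₂ + toSite b')) j i = _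
    rw [hP κ y₁ b hb κ' y₂ b' hb']; rfl
  have h := (blockPairTotal_eq_of_bothIndexed (P := fun u u' => blk (P κ u κ' u') j i) (c := c κ) (c' := c κ')
    (J := blk (J κ y₁ κ' y₂) j i) y₁ y₂ hblk (hJs κ y₁ κ' y₂ j i)).2
  rw [h]
  have hM0 : 0 ≤ ∑' p : Site 4 × Site 4, ∑ g, ∑ f, |blk (J κ y₁ κ' y₂) j i p.1 p.2 g f| :=
    tsum_nonneg fun p => Finset.sum_nonneg fun g _ => Finset.sum_nonneg fun f _ => abs_nonneg _
  have hL0 : 0 ≤ ∑ b' ∈ box 4 N, |c κ' (((N : ℕ) : ℤ) • y₂ + toSite b')| := Finset.sum_nonneg fun _ _ => abs_nonneg _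
  calc (∑ b ∈ box 4 N, |c κ (((N : ℕ) : ℤ) • y₁ + toSite b)|) * (∑ b' ∈ box 4 N, |c κ' (((N : ℕ) : ℤ) • y₂ + toSite b')|)
          * ∑' p : Site 4 × Site 4, ∑ g, ∑ f, |blk (J κ y₁ κ' y₂) j i p.1 p.2 g f|
      ≤ (((N : ℝ) * cW) * ((N : ℝ) * cW)) * ((N : ℝ) ^ 6 * mJ j i * Real.exp (-θ * l1 (y₂ - y₁))) :=
        mul_le_mul (mul_le_mul (hcB κ y₁) (hcB κ' y₂) hL0 (by positivity)) (hJB κ κ' y₁ y₂ j i) hM0 (by positivity)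
    _ = (N : ℝ) ^ 8 * (cW ^ 2 * mJ j i) * Real.exp (-θ * l1 (y₂ - y₁)) := by ring

end Pieces

/-! ## §3 The (M-b) packed bi-vertex rows of the three pieces at the road's weights `G₀^{bm}(r)`, any block size `[NeZero N]` -/

section Rows

variable (N : ℕ) [NeZero N] {r : Fin (3 + 1) → ℕ} (hr : r ∈ box (3 + 1) N)
include hr

/-- [folklore] **«PAIR-FACE-PACK», OUTER-FACE × RAW**: for a pair family block-indexed in the OUTER slot (`hP`), every slot pair summable (`hGs` — any `u′`, and the
outer slot rides the structure), the weights' block-ℓ¹ law `hcB` and the «face × block» letter `hGB` with coarse decay `0 < θ`: every block of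
`vertex2OfK (G₀^{bm} r) N P μ y ν y′` has summable plain mass
`≤ 16·C_{G₀}²·(e^{κ′}·e^{κ′})·(Zl 4 (κ′∕8)·Zl 4 (θ∕2))·(cW·m̄G j i)·e^{−min (κ′∕8) (θ∕2)|y′−y|₁}` (`PackedColumnBlockTotalScales.mass_blk_vertex2OfK_G₀_le_of_blockPairTotal_at`). -/
theorem mass_blk_vertex2OfK_G₀_le_of_outerIndexed {P : Fin 4 → Site 4 → Fin 4 → Site 4 → MKer 4 (Fib 3)} {c : Fin 4 → Site 4 → ℝ}
    {G : Fin 4 → Site 4 → Fin 4 → Site 4 → MKer 4 (Fib 3)} {cW θ : ℝ} {mG : Bool → Bool → ℝ} (hcW : 0 ≤ cW) (hθ : 0 < θ)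
    (hP : ∀ (κ : Fin 4) (y₁ : Site 4), ∀ b ∈ box 4 N, ∀ (κ' : Fin 4) (u' : Site 4),
      P κ (((N : ℕ) : ℤ) • y₁ + toSite b) κ' u' = c κ (((N : ℕ) : ℤ) • y₁ + toSite b) • G κ y₁ κ' u')
    (hGs : ∀ κ y₁ κ' u' j i, Summable fun p : Site 4 × Site 4 => ∑ g, ∑ f, |blk (G κ y₁ κ' u') j i p.1 p.2 g f|)
    (hcB : ∀ (κ : Fin 4) (y₁ : Site 4), ∑ b ∈ box 4 N, |c κ (((N : ℕ) : ℤ) • y₁ + toSite b)| ≤ (N : ℝ) * cW)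
    (hGB : ∀ (κ κ' : Fin 4) (y₁ y₂ : Site 4) (j i : Bool), ∑ b' ∈ box 4 N,
      (∑' p : Site 4 × Site 4, ∑ g, ∑ f, |blk (G κ y₁ κ' (((N : ℕ) : ℤ) • y₂ + toSite b')) j i p.1 p.2 g f|)
        ≤ (N : ℝ) ^ 7 * mG j i * Real.exp (-θ * l1 (y₂ - y₁)))
    (μ : Fin 4) (y : Site 4) (ν : Fin 4) (y' : Site 4) (j i : Bool) :
    (Summable fun p : Site 4 × Site 4 => ∑ g, ∑ f,
        |blk (vertex2OfK (coDressKBmAt (toSite r) N (KInvStep (d := 3) N 0)) N P μ y ν y') j i p.1 p.2 g f|) ∧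
      ∑' p : Site 4 × Site 4, ∑ g, ∑ f,
          |blk (vertex2OfK (coDressKBmAt (toSite r) N (KInvStep (d := 3) N 0)) N P μ y ν y') j i p.1 p.2 g f|
        ≤ 16 * ((MG163 4 * periodConst (kappa163 4) 3) * (1 + 8 * (1 + Real.exp (kappa163 4 / 4))) * Real.exp (kappa163 4 / 4)) ^ 2
            * (Real.exp (kappa163 4 / 4) * Real.exp (kappa163 4 / 4)) * (Zl 4 (kappa163 4 / 4 / 8) * Zl 4 (θ / 2))
          * (cW * mG j i) * Real.exp (-(min (kappa163 4 / 4 / 8) (θ / 2)) * l1 (y' - y)) := by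
  have hN1 : 1 ≤ N := Nat.one_le_iff_ne_zero.mpr (NeZero.ne N)
  -- per slot pair: the outer slot `u = N•blk u + off u` rides the structure
  have hTs : ∀ κ u κ' u' j i, Summable fun p : Site 4 × Site 4 => ∑ g, ∑ f, |blk (P κ u κ' u') j i p.1 p.2 g f| := by
    intro κ u κ' u' j i
    have hu : ((N : ℕ) : ℤ) • AveragingContours.blk N u + toSite (AveragingContours.off N u) = u := AveragingContours.blk_add_off hN1 u
    have h := hP κ (AveragingContours.blk N u) (AveragingContours.off N u) (AveragingContours.off_mem_box hN1 u) κ' u'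
    rw [hu] at h
    rw [show blk (P κ u κ' u') j i = c κ u • blk (G κ (AveragingContours.blk N u) κ' u') j i by rw [h]; rfl]
    exact (mass_smul_le _ (hGs κ _ κ' u' j i)).1
  exact mass_blk_vertex2OfK_G₀_le_of_blockPairTotal_at N hr hθ hTs (hTB_of_outerIndexed N hcW hP hGs hcB hGB) μ y ν y' j i

/-- [folklore] **«PAIR-FACE-PACK», RAW × INNER-FACE** (inner slot block-indexed). -/
theorem mass_blk_vertex2OfK_G₀_le_of_innerIndexed {P : Fin 4 → Site 4 → Fin 4 → Site 4 → MKer 4 (Fib 3)} {c : Fin 4 → Site 4 → ℝ}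
    {H : Fin 4 → Site 4 → Fin 4 → Site 4 → MKer 4 (Fib 3)} {cW θ : ℝ} {mH : Bool → Bool → ℝ} (hcW : 0 ≤ cW) (hθ : 0 < θ)
    (hP : ∀ (κ : Fin 4) (u : Site 4) (κ' : Fin 4) (y₂ : Site 4), ∀ b' ∈ box 4 N,
      P κ u κ' (((N : ℕ) : ℤ) • y₂ + toSite b') = c κ' (((N : ℕ) : ℤ) • y₂ + toSite b') • H κ u κ' y₂)
    (hHs : ∀ κ u κ' y₂ j i, Summable fun p : Site 4 × Site 4 => ∑ g, ∑ f, |blk (H κ u κ' y₂) j i p.1 p.2 g f|)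
    (hcB : ∀ (κ' : Fin 4) (y₂ : Site 4), ∑ b' ∈ box 4 N, |c κ' (((N : ℕ) : ℤ) • y₂ + toSite b')| ≤ (N : ℝ) * cW)
    (hHB : ∀ (κ κ' : Fin 4) (y₁ y₂ : Site 4) (j i : Bool), ∑ b ∈ box 4 N,
      (∑' p : Site 4 × Site 4, ∑ g, ∑ f, |blk (H κ (((N : ℕ) : ℤ) • y₁ + toSite b) κ' y₂) j i p.1 p.2 g f|)
        ≤ (N : ℝ) ^ 7 * mH j i * Real.exp (-θ * l1 (y₂ - y₁)))
    (μ : Fin 4) (y : Site 4) (ν : Fin 4) (y' : Site 4) (j i : Bool) :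
    (Summable fun p : Site 4 × Site 4 => ∑ g, ∑ f,
        |blk (vertex2OfK (coDressKBmAt (toSite r) N (KInvStep (d := 3) N 0)) N P μ y ν y') j i p.1 p.2 g f|) ∧
      ∑' p : Site 4 × Site 4, ∑ g, ∑ f,
          |blk (vertex2OfK (coDressKBmAt (toSite r) N (KInvStep (d := 3) N 0)) N P μ y ν y') j i p.1 p.2 g f|
        ≤ 16 * ((MG163 4 * periodConst (kappa163 4) 3) * (1 + 8 * (1 + Real.exp (kappa163 4 / 4))) * Real.exp (kappa163 4 / 4)) ^ 2
            * (Real.exp (kappa163 4 / 4) * Real.exp (kappa163 4 / 4)) * (Zl 4 (kappa163 4 / 4 / 8) * Zl 4 (θ / 2))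
          * (cW * mH j i) * Real.exp (-(min (kappa163 4 / 4 / 8) (θ / 2)) * l1 (y' - y)) := by
  have hN1 : 1 ≤ N := Nat.one_le_iff_ne_zero.mpr (NeZero.ne N)
  have hTs : ∀ κ u κ' u' j i, Summable fun p : Site 4 × Site 4 => ∑ g, ∑ f, |blk (P κ u κ' u') j i p.1 p.2 g f| := by
    intro κ u κ' u' j i
    have hu : ((N : ℕ) : ℤ) • AveragingContours.blk N u' + toSite (AveragingContours.off N u') = u' := AveragingContours.blk_add_off hN1 u'
    have h := hP κ u κ' (AveragingContours.blk N u') (AveragingContours.off N u') (AveragingContours.off_mem_box hN1 u')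
    rw [hu] at h
    rw [show blk (P κ u κ' u') j i = c κ' u' • blk (H κ u κ' (AveragingContours.blk N u')) j i by rw [h]; rfl]
    exact (mass_smul_le _ (hHs κ u κ' _ j i)).1
  exact mass_blk_vertex2OfK_G₀_le_of_blockPairTotal_at N hr hθ hTs (hTB_of_innerIndexed N hcW hP hHs hcB hHB) μ y ν y' j i

/-- [folklore] **«PAIR-FACE-PACK», FACE × FACE** (both slots block-indexed). -/
theorem mass_blk_vertex2OfK_G₀_le_of_bothIndexed {P : Fin 4 → Site 4 → Fin 4 → Site 4 → MKer 4 (Fib 3)} {c : Fin 4 → Site 4 → ℝ}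
    {J : Fin 4 → Site 4 → Fin 4 → Site 4 → MKer 4 (Fib 3)} {cW θ : ℝ} {mJ : Bool → Bool → ℝ} (hcW : 0 ≤ cW) (hθ : 0 < θ)
    (hP : ∀ (κ : Fin 4) (y₁ : Site 4), ∀ b ∈ box 4 N, ∀ (κ' : Fin 4) (y₂ : Site 4), ∀ b' ∈ box 4 N,
      P κ (((N : ℕ) : ℤ) • y₁ + toSite b) κ' (((N : ℕ) : ℤ) • y₂ + toSite b')
        = (c κ (((N : ℕ) : ℤ) • y₁ + toSite b) * c κ' (((N : ℕ) : ℤ) • y₂ + toSite b')) • J κ y₁ κ' y₂)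
    (hJs : ∀ κ y₁ κ' y₂ j i, Summable fun p : Site 4 × Site 4 => ∑ g, ∑ f, |blk (J κ y₁ κ' y₂) j i p.1 p.2 g f|)
    (hcB : ∀ (κ : Fin 4) (y : Site 4), ∑ b ∈ box 4 N, |c κ (((N : ℕ) : ℤ) • y + toSite b)| ≤ (N : ℝ) * cW)
    (hJB : ∀ (κ κ' : Fin 4) (y₁ y₂ : Site 4) (j i : Bool),
      (∑' p : Site 4 × Site 4, ∑ g, ∑ f, |blk (J κ y₁ κ' y₂) j i p.1 p.2 g f|) ≤ (N : ℝ) ^ 6 * mJ j i * Real.exp (-θ * l1 (y₂ - y₁)))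
    (μ : Fin 4) (y : Site 4) (ν : Fin 4) (y' : Site 4) (j i : Bool) :
    (Summable fun p : Site 4 × Site 4 => ∑ g, ∑ f,
        |blk (vertex2OfK (coDressKBmAt (toSite r) N (KInvStep (d := 3) N 0)) N P μ y ν y') j i p.1 p.2 g f|) ∧
      ∑' p : Site 4 × Site 4, ∑ g, ∑ f,
          |blk (vertex2OfK (coDressKBmAt (toSite r) N (KInvStep (d := 3) N 0)) N P μ y ν y') j i p.1 p.2 g f|
        ≤ 16 * ((MG163 4 * periodConst (kappa163 4) 3) * (1 + 8 * (1 + Real.exp (kappa163 4 / 4))) * Real.exp (kappa163 4 / 4)) ^ 2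
            * (Real.exp (kappa163 4 / 4) * Real.exp (kappa163 4 / 4)) * (Zl 4 (kappa163 4 / 4 / 8) * Zl 4 (θ / 2))
          * (cW ^ 2 * mJ j i) * Real.exp (-(min (kappa163 4 / 4 / 8) (θ / 2)) * l1 (y' - y)) := by
  have hN1 : 1 ≤ N := Nat.one_le_iff_ne_zero.mpr (NeZero.ne N)
  have hTs : ∀ κ u κ' u' j i, Summable fun p : Site 4 × Site 4 => ∑ g, ∑ f, |blk (P κ u κ' u') j i p.1 p.2 g f| := by
    intro κ u κ' u' j i
    have hu : ((N : ℕ) : ℤ) • AveragingContours.blk N u + toSite (AveragingContours.off N u) = u := AveragingContours.blk_add_off hN1 u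
    have hu' : ((N : ℕ) : ℤ) • AveragingContours.blk N u' + toSite (AveragingContours.off N u') = u' := AveragingContours.blk_add_off hN1 u'
    have h := hP κ (AveragingContours.blk N u) (AveragingContours.off N u) (AveragingContours.off_mem_box hN1 u)
      κ' (AveragingContours.blk N u') (AveragingContours.off N u') (AveragingContours.off_mem_box hN1 u')
    rw [hu, hu'] at h
    rw [show blk (P κ u κ' u') j i = (c κ u * c κ' u') • blk (J κ (AveragingContours.blk N u) κ' (AveragingContours.blk N u')) j i by
      rw [h]; rfl]
    exact (mass_smul_le _ (hJs κ _ κ' _ j i)).1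
  exact mass_blk_vertex2OfK_G₀_le_of_blockPairTotal_at N hr hθ hTs (hTB_of_bothIndexed N hcW hP hJs hcB hJB) μ y ν y' j i

end Rows

end Summit.QuantumFields.BalabanUV.Beta.D1BFx.PackedPairBlockIndexedMass

end
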